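import Mathlib
import Summits.Ventures.FusionMHD.Models.RwmFRS1Kq08Solution
import Summits.Ventures.FusionMHD.Models.RwmFRS1Kq07RateSharp
import Summits.Ventures.FusionMHD.Models.RwmFRS1Energy
import Summits.Ventures.FusionMHD.Models.ResistiveSchemas
import HarnessLib

/-!
# F3.r4 instance «RwmFRS1Kq08» (candidate row «F3.r4-KINKEQ08-RWM21»): THE SENTENCES — no-wall instability of the external
# `(2,1)` mode of the `q_a = 8/5 < 2` screw pinch, the ideal-wall window out to `b = 6/5·a`, the critical wall radius
# `b* ∈ (6/5·a, 13/10·a)` — CLOSER than the `q_a = 7/5` member's `b* ∈ (31/20·a, 8/5·a)` — and the certified thin-wall RWM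
# growth rate `4.15 < γτ_w < 4.5` at `b = 6/5·a` (vs `0.267 < γτ_w < 0.2731` for the `q_a = 7/5` member at the same wall)

Assembly file (model-6 g8) of the chain `RwmFRS1Kq08` → `…Axis` → `…AxisData` → `…AxisJets` → `…AxisValues` → `…Chain` →
`…Solution` (the axis-regular marginal solution `ξ₁ = Kq08.xi`, odd, `C¹` through the axis, no zero on `(0, a]`,
`3.9795679 < L_8 = aξ₁′/ξ₁(a) < 3.9795680`), with the model-independent `m = 2` wall factors of row #109 BY NAME
(`RwmFRS1Kq07Bessel`: `Λ_∞(2, 1/5) ∈ [0.99, 0.9909]`, `Λ_b(2, 1/5, 6/25) ∈ [2.771, 2.906]`, `Λ_b(2, 1/5, 13/50) ≤ 2.099`;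
`RwmFRS1Kq07BesselSharp`: `Λ_b(2, 1/5, 6/25) ∈ [2.8178, 2.8448]` — same `m`, same `|k|a = 1/5`, so nothing is recomputed).
It COMPOSES, BY NAME: lit-4's PROVED external-mode test `ScrewPinch.Profile.newcombExternalModes_iff` [Freidberg2014 §11.5.3
(11.117)–(11.118)] and `fluidEnergy_eq_boundary_of_solution` (so `δW_∞`, `δW_b` of (11.148)–(11.149) ARE
`externalEnergy 2 k 1 Λ ξ₁ = δŴ(L, Λ)·ξ₁(1)²`, `δŴ(L, Λ) = (L − 9)/1616 + Λ/800`, `Kq08.boundaryForm_eq`); lit-3's wall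
factors [(11.96), (11.150)] with `Λ_∞ < 1` (§8) and the §12 critical wall radius `Profile.criticalWallRadius`; model-6's
`ResistiveWall.IsThinWallRate` [(11.169)]; the admissibility class `RwmFRS1.IsAdmissible` of row #71.

CERTIFIED SENTENCES (MODEL M_RWM,8 = the EXACT force-balanced `q₀ = 4/5` member `Kq08.P8` (`q = (4/5)(1+r²)`, `q_a = 8/5`,
`β₀ = 151/3200`; `Kq08.isRadialPressureBalance`) + vacuum + thin resistive wall, `R₀ = 5a` DECLARED; `q₀ = 4/5` and the wall
radii `b/a ∈ {6/5, 13/10}` DECLARED SYNTHETIC; CLASS C = external `(m,n) = (2,1)`, `q = 2` in the vacuum at `r² = 3/2`):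
1. `lambdaCrit_bounds` — `Λ_crit = 50(9 − L_8)/101 ∈ (2.485362, 2.485363)`;
2. **`dWinf_neg`**, **`noWall_not_stable`** — `δW_∞ < 0` from lit-3's GENERIC `Λ_∞ < 1 < Λ_crit` (no Bessel value needed):
   without a wall the `(2,1)` external kink side of M_RWM,8 (VALIDATED: tokamak band (11.221) `1.3235 < nq_a = 1.6 < 2`);
3. **`dWb_pos`** (`b = 6/5·a`: `Λ_b ≥ 2.771 > Λ_crit`), **`idealWall_stable`**, **`idealWall_window`** (every `a < b ≤ 6/5·a`);
   **`dWb_neg`** (`b = 13/10·a`: `Λ_b ≤ 2.099 < Λ_crit`), **`dWb_neg_far`** (every `b ≥ 13/10·a`); hence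
   **`criticalWallRadius_bounds`: `6/5·a < b* < 13/10·a`**, **`idealWall_stable_iff`** (`b < b*`), and the JUXTAPOSITION
   with row #109 **`criticalWallRadius_lt_Kq07`: `b*(M_RWM,8) < 13/10·a < 31/20·a < b*(M_RWM,K)`** — one step up in `q_a`
   (`7/5 → 8/5`) inside the same family the conducting wall must come CLOSER to the plasma (two kernel rows, never merged);
4. **`rwm_rate_12`** — thin wall at `b = 6/5·a`: every `γ` with `γτ_w·δW_b = −δW_∞` satisfies **`4.15 < γτ_w < 4.5`** (sharp
   `K_2` brackets of `RwmFRS1Kq07BesselSharp`; the coarse ones would give `(3.55, 5.24)`); `rwm_grows_of_lt` / `rwm_grows` — `γ > 0`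
   for every thin wall `a < b < b*` (`τ_w > 0`); versus row #109's `0.267 < γτ_w < 0.2731` at the SAME wall `b = 6/5·a`
   (`Kq07.rwm_rate_12_sharp`): **`rwm_rate_12_gt_Kq07`** — at least fifteen times faster in units of `τ_w`.
VALIDATED (not load-bearing): float `L = 3.979568`, `Λ_∞ = 0.99045`, `Λ_crit = 2.48536`, `b_crit = 1.2343a`, `γτ_w(6/5·a) =
4.334` (work/preview/preview_q0.py, model-6 g8).  HONESTY: the same member's internal `(1,1)` kink (resonant at `q = 1`,
`r² = 1/4`) is NOT treated here; never «stable/unstable» without «MODEL M_RWM,8, mode (2,1)»; nothing about a device. [instance data]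
-/

noncomputable section

open Set Filter Polynomial Literature.Analysis.ODE Literature.Analysis.FunctionSpaces
  Literature.MathematicalPhysics.MHD Literature.MathematicalPhysics.MHD.ScrewPinch
open scoped Topology

namespace Summit.Ventures.FusionMHD.Models

namespace RwmFRS1

namespace Kq08

/-! ### The reference energies of the marginal solution are the boundary form (Freidberg (11.148)) -/

/-- **(11.148) FOR `ξ₁`** (MODEL M_RWM,8, `m = 2`): for every wall factor `Λ`,
`externalEnergy 2 k 1 Λ ξ₁ = δŴ(L_8, Λ)·ξ₁(1)²`, `L_8 = ξ₁′(1)/ξ₁(1)`. [cite: Freidberg2014, §11.5.6 eq. (11.148)] -/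
theorem externalEnergy_xi (Λ : ℝ) :
    P8.externalEnergy 2 kk 1 Λ Kq08.xi = Kq08.boundaryForm (1 * deriv Kq08.xi 1 / Kq08.xi 1) Λ * Kq08.xi 1 ^ 2 := by
  obtain ⟨hBθ, hBz, hp, hBθ0⟩ := profile_regular (51 / 50)
  have hF : ∀ r ∈ Ioc (0 : ℝ) 1, P8.kDotB 2 kk r ≠ 0 := fun r hr => kDotB_ne_zero hr.1 (by nlinarith [hr.1, hr.2])
  have hODE : ∀ r ∈ Ioo (0 : ℝ) 1,
      HasDerivAt (fun s => P8.newcombF 2 kk s * deriv Kq08.xi s) (P8.newcombG 2 kk r * Kq08.xi r) r :=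
    fun r hr => xi_newcomb ⟨hr.1, by linarith [hr.2]⟩
  have hE := Profile.fluidEnergy_eq_boundary_of_solution (P := P8) (m := 2) (k := kk) one_pos
    (by norm_num : (1 : ℝ) < 51 / 50) (by norm_num) hBθ hBz hp hBθ0 hF xi_contDiffOn hODE
  have hx : Kq08.xi 1 ≠ 0 := xi_ne_zero 1 ⟨one_pos, le_rfl⟩
  unfold Profile.externalEnergy
  rw [hE, Kq08.boundaryForm]
  unfold Profile.newcombF
  field_simp
  ring

/-- The NO-WALL reference energy `δW_∞` of the marginal solution (per `2π²R₀/μ₀`), MODEL M_RWM,8, mode `(2,1)`.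
[cite: Freidberg2014, §11.5.6 eq. (11.149)] -/
def dWinf : ℝ := P8.externalEnergy 2 kk 1 (Vacuum.wallFactorInf 2 kk 1) Kq08.xi

/-- The IDEAL-WALL reference energy `δW_b` of the marginal solution, wall at `r = b`, MODEL M_RWM,8, mode `(2,1)`.
[cite: Freidberg2014, §11.5.6 eq. (11.149)] -/
def dWb (b : ℝ) : ℝ := P8.externalEnergy 2 kk 1 (Vacuum.wallFactor 2 kk 1 b) Kq08.xi

/-- `ξ₁(1)² > 0`. [instance data] -/
theorem xi_one_sq_pos : 0 < Kq08.xi 1 ^ 2 := by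
  have := xi_pos one_pos le_rfl
  positivity

/-! ### Sentence 1: the critical wall factor -/

/-- **`Λ_crit ∈ (2.485362, 2.485363)`** (from `3.9795679 < L_8 < 3.9795680`). [instance data] -/
theorem lambdaCrit_bounds : (2485362 / 1000000 : ℝ) < Kq08.lambdaCrit (1 * deriv Kq08.xi 1 / Kq08.xi 1) ∧
    Kq08.lambdaCrit (1 * deriv Kq08.xi 1 / Kq08.xi 1) < (2485363 / 1000000 : ℝ) := by
  obtain ⟨h1, h2⟩ := L_bounds
  unfold Kq08.lambdaCrit
  constructor <;> linarith

/-! ### Sentences 2–3: energies of the marginal solution and the external-mode test -/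

/-- **SENTENCE 2 (no wall): `δW_∞ < 0`** — `Λ_∞ < 1 < Λ_crit` (lit-3's generic bound; no Bessel value needed).
[cite: Freidberg2014, §11.5.6 eq. (11.149), (11.151)] -/
theorem dWinf_neg : Kq08.dWinf < 0 := by
  rw [Kq08.dWinf, externalEnergy_xi]
  have hΛ : Vacuum.wallFactorInf 2 kk 1 < 1 :=
    Vacuum.wallFactorInf_lt_one (by norm_num) (by rw [kk]; norm_num) one_pos
  have hneg : Kq08.boundaryForm (1 * deriv Kq08.xi 1 / Kq08.xi 1) (Vacuum.wallFactorInf 2 kk 1) < 0 := by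
    rw [boundaryForm_neg_iff]
    linarith [lambdaCrit_bounds.1]
  exact mul_neg_of_neg_of_pos hneg xi_one_sq_pos

/-- **SENTENCE 3 (ideal wall at `b = 6/5·a`): `δW_b > 0`** — `Λ_b ≥ 2.771 > Λ_crit` (row #109's bracket
`Kq07.lambdaWall_24_bounds`, by name). [cite: Freidberg2014, §11.5.6 eq. (11.149), (11.151)] -/
theorem dWb_pos : 0 < Kq08.dWb (6 / 5) := by
  rw [Kq08.dWb, externalEnergy_xi]
  have hΛ : (2771 / 1000 : ℝ) ≤ Vacuum.wallFactor 2 kk 1 (6 / 5) := by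
    rw [Kq07.wallFactor_two_eq, show (1 / 5 : ℝ) * (6 / 5) = 6 / 25 by norm_num]
    exact Kq07.lambdaWall_24_bounds.1
  have hpos : 0 < Kq08.boundaryForm (1 * deriv Kq08.xi 1 / Kq08.xi 1) (Vacuum.wallFactor 2 kk 1 (6 / 5)) := by
    rw [boundaryForm_pos_iff]
    linarith [lambdaCrit_bounds.2]
  exact mul_pos hpos xi_one_sq_pos

/-- **Ideal wall at `b = 13/10·a`: `δW_b < 0`** — `Λ_b ≤ 2.099 < Λ_crit` (wall too far; row #109's bracket
`Kq07.lambdaWall_26_bounds`, by name). [cite: Freidberg2014, §11.5.6 eq. (11.149)] -/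
theorem dWb_neg : Kq08.dWb (13 / 10) < 0 := by
  rw [Kq08.dWb, externalEnergy_xi]
  have hΛ : Vacuum.wallFactor 2 kk 1 (13 / 10) ≤ (2099 / 1000 : ℝ) := by
    rw [Kq07.wallFactor_two_eq, show (1 / 5 : ℝ) * (13 / 10) = 13 / 50 by norm_num]
    exact Kq07.lambdaWall_26_bounds.2
  have hneg : Kq08.boundaryForm (1 * deriv Kq08.xi 1 / Kq08.xi 1) (Vacuum.wallFactor 2 kk 1 (13 / 10)) < 0 := by
    rw [boundaryForm_neg_iff]
    linarith [lambdaCrit_bounds.1]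
  exact mul_neg_of_neg_of_pos hneg xi_one_sq_pos

/-- The marginal solution `ξ₁` is admissible (row #71's class `RwmFRS1.IsAdmissible`). [instance data] -/
theorem xi_admissible : IsAdmissible Kq08.xi :=
  ⟨xi_contDiffOn, 1, ⟨zero_le_one, le_rfl⟩, xi_ne_zero 1 ⟨one_pos, le_rfl⟩⟩

/-- **NEWCOMB'S EXTERNAL-MODE TEST FOR MODEL M_RWM,8, MODE `(2,1)`** (lit-4's `newcombExternalModes_iff` instantiated with
the kernel solution `ξ₁`): for every wall factor `Λ`, ALL admissible displacements have positive external energy iff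
`δŴ(L_8, Λ)·ξ₁(1)² > 0`. [cite: Freidberg2014, §11.5.3 eq. (11.118)] -/
theorem externalModes_iff (Λ : ℝ) :
    (∀ ξ : ℝ → ℝ, IsAdmissible ξ → 0 < P8.externalEnergy 2 kk 1 Λ ξ) ↔
      0 < Kq08.boundaryForm (1 * deriv Kq08.xi 1 / Kq08.xi 1) Λ * Kq08.xi 1 ^ 2 := by
  obtain ⟨hBθ, hBz, hp, hBθ0⟩ := profile_regular (51 / 50)
  have hF : ∀ r ∈ Ioc (0 : ℝ) 1, P8.kDotB 2 kk r ≠ 0 := fun r hr => kDotB_ne_zero hr.1 (by nlinarith [hr.1, hr.2])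
  have hODE : ∀ r ∈ Ioo (0 : ℝ) 1,
      HasDerivAt (fun s => P8.newcombF 2 kk s * deriv Kq08.xi s) (P8.newcombG 2 kk r * Kq08.xi r) r :=
    fun r hr => xi_newcomb ⟨hr.1, by linarith [hr.2]⟩
  have h := Profile.newcombExternalModes_iff (P := P8) (m := 2) (k := kk) one_pos (by norm_num : (1 : ℝ) < 51 / 50)
    (by norm_num) hBθ hBz hp hBθ0 hF xi_contDiffOn hODE xi_ne_zero Λ
  rw [boundaryForm_mul] at h
  constructor
  · intro hall
    exact h.1 fun ξ hξ hne => hall ξ ⟨hξ, hne⟩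
  · intro hpos ξ hξ
    exact h.2 hpos ξ hξ.1 hξ.2

/-- **SENTENCE 2′ (no wall): NOT every admissible displacement has positive no-wall energy** — `ξ₁` itself has
`δW_∞ < 0` (the external `(2,1)` kink side of MODEL M_RWM,8; never «the device is unstable»).
[cite: Freidberg2014, §11.5.6 eq. (11.151)] -/
theorem noWall_not_stable :
    ¬ (∀ ξ : ℝ → ℝ, IsAdmissible ξ → 0 < P8.externalEnergy 2 kk 1 (Vacuum.wallFactorInf 2 kk 1) ξ) := by
  intro hall
  have h := hall Kq08.xi xi_admissible
  have h2 := dWinf_neg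
  rw [Kq08.dWinf] at h2
  linarith

/-- **SENTENCE 3′ (ideal wall at `b = 6/5·a`): EVERY admissible displacement has positive ideal-wall energy** in MODEL
M_RWM,8, mode `(2,1)` (wall-stabilised side). [cite: Freidberg2014, §11.5.6 eq. (11.151)] -/
theorem idealWall_stable :
    ∀ ξ : ℝ → ℝ, IsAdmissible ξ → 0 < P8.externalEnergy 2 kk 1 (Vacuum.wallFactor 2 kk 1 (6 / 5)) ξ := by
  have h := dWb_pos
  rw [Kq08.dWb, externalEnergy_xi] at h
  exact (externalModes_iff _).2 h

/-- **THE IDEAL-WALL WINDOW**: for every DECLARED wall radius `a < b ≤ 6/5·a` all admissible displacements have positive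
energy in MODEL M_RWM,8, mode `(2,1)` (`Λ_b` is decreasing in `b`, lit-3 `strictAntiOn_wallFactor`).
[cite: Freidberg2014, §11.5.6 eq. (11.150)–(11.151)] -/
theorem idealWall_window {b : ℝ} (hb1 : 1 < b) (hb2 : b ≤ 6 / 5) :
    ∀ ξ : ℝ → ℝ, IsAdmissible ξ → 0 < P8.externalEnergy 2 kk 1 (Vacuum.wallFactor 2 kk 1 b) ξ := by
  have hk : kk ≠ 0 := by rw [kk]; norm_num
  have hmono := Vacuum.strictAntiOn_wallFactor (m := 2) (by norm_num) hk one_pos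
  have hΛ : Vacuum.wallFactor 2 kk 1 (6 / 5) ≤ Vacuum.wallFactor 2 kk 1 b := by
    rcases eq_or_lt_of_le hb2 with h | h
    · rw [h]
    · exact (hmono (show (1 : ℝ) < b from hb1) (show (1 : ℝ) < 6 / 5 by norm_num) h).le
  have h32 := dWb_pos
  rw [Kq08.dWb, externalEnergy_xi] at h32
  refine (externalModes_iff _).2 ?_
  have hx := xi_one_sq_pos
  have hmonoB := (boundaryForm_strictMono (1 * deriv Kq08.xi 1 / Kq08.xi 1)).monotone hΛ
  have : 0 < Kq08.boundaryForm (1 * deriv Kq08.xi 1 / Kq08.xi 1) (Vacuum.wallFactor 2 kk 1 (6 / 5)) :=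
    pos_of_mul_pos_left h32 hx.le
  exact mul_pos (lt_of_lt_of_le this hmonoB) hx

/-- **Far walls do not stabilise**: for every `b ≥ 13/10·a` the marginal solution `ξ₁` has negative ideal-wall energy
(MODEL M_RWM,8, mode `(2,1)`). [cite: Freidberg2014, §11.5.6 eq. (11.150)] -/
theorem dWb_neg_far {b : ℝ} (hb : 13 / 10 ≤ b) : Kq08.dWb b < 0 := by
  have hk : kk ≠ 0 := by rw [kk]; norm_num
  have hmono := Vacuum.strictAntiOn_wallFactor (m := 2) (by norm_num) hk one_pos
  have hΛ : Vacuum.wallFactor 2 kk 1 b ≤ Vacuum.wallFactor 2 kk 1 (13 / 10) := by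
    rcases eq_or_lt_of_le hb with h | h
    · rw [h]
    · exact (hmono (show (1 : ℝ) < 13 / 10 by norm_num) (show (1 : ℝ) < b by linarith) h).le
  have h74 := dWb_neg
  rw [Kq08.dWb, externalEnergy_xi] at h74 ⊢
  have hx := xi_one_sq_pos
  have hmonoB := (boundaryForm_strictMono (1 * deriv Kq08.xi 1 / Kq08.xi 1)).monotone hΛ
  have : Kq08.boundaryForm (1 * deriv Kq08.xi 1 / Kq08.xi 1) (Vacuum.wallFactor 2 kk 1 (13 / 10)) < 0 :=
    neg_of_mul_neg_left (by linarith) hx.le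
  exact mul_neg_of_neg_of_pos (lt_of_le_of_lt hmonoB this) hx

/-! ### The critical wall radius `b*` (lit-3 §12, by name) -/

/-- The hypotheses of lit-3's critical-wall theorems for the `(2,1)` marginal solution of MODEL M_RWM,8: `F_a ≠ 0`, `ξ₁(a) ≠ 0`,
`δW_∞ < 0` (mode number as the natural number `2`). [instance data] -/
theorem criticalWall_hyps : P8.kDotB ((2 : ℕ) : ℝ) kk 1 ≠ 0 ∧ Kq08.xi 1 ≠ 0 ∧
    P8.externalEnergy ((2 : ℕ) : ℝ) kk 1 (Vacuum.wallFactorInf 2 kk 1) Kq08.xi < 0 := by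
  have h1 : P8.kDotB 2 kk 1 ≠ 0 := by rw [edge_values.1]; norm_num
  have h3 := dWinf_neg
  rw [Kq08.dWinf] at h3
  refine ⟨?_, xi_ne_zero 1 ⟨one_pos, le_rfl⟩, ?_⟩
  · simpa only [Nat.cast_ofNat] using h1
  · simpa only [Nat.cast_ofNat] using h3

/-- **`δW_b > 0 ⇔ b < b*`** for every wall `b > a = 1` (MODEL M_RWM,8, mode `(2,1)`).
[cite: Freidberg2014, §11.5.6 eqs. (11.149)–(11.151), p. 491] -/
theorem dWb_pos_iff {b : ℝ} (hb : 1 < b) : 0 < Kq08.dWb b ↔ b < P8.criticalWallRadius 2 kk 1 Kq08.xi := by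
  obtain ⟨hF, hξ, hinf⟩ := criticalWall_hyps
  have hk : kk ≠ 0 := by rw [kk]; norm_num
  have h := P8.externalEnergy_wall_pos_iff (m := 2) (by norm_num) hk one_pos hF hξ hinf hb
  rw [Kq08.dWb]
  simpa only [Nat.cast_ofNat] using h

/-- **`δW_b < 0 ⇔ b* < b`** for every wall `b > a = 1` (MODEL M_RWM,8, mode `(2,1)`).
[cite: Freidberg2014, §11.5.6 eqs. (11.149)–(11.151), p. 491] -/
theorem dWb_neg_iff {b : ℝ} (hb : 1 < b) : Kq08.dWb b < 0 ↔ P8.criticalWallRadius 2 kk 1 Kq08.xi < b := by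
  obtain ⟨hF, hξ, hinf⟩ := criticalWall_hyps
  have hk : kk ≠ 0 := by rw [kk]; norm_num
  have h := P8.externalEnergy_wall_neg_iff (m := 2) (by norm_num) hk one_pos hF hξ hinf hb
  rw [Kq08.dWb]
  simpa only [Nat.cast_ofNat] using h

/-- **`6/5·a < b* < 13/10·a`**: the critical wall radius of the `(2,1)` mode of MODEL M_RWM,8 lies strictly between the two
DECLARED wall radii (`δW_b(6/5) > 0`, `δW_b(13/10) < 0`; VALIDATED float `1.2343a`). [instance data] -/
theorem criticalWallRadius_bounds : (6 / 5 : ℝ) < P8.criticalWallRadius 2 kk 1 Kq08.xi ∧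
    P8.criticalWallRadius 2 kk 1 Kq08.xi < (13 / 10 : ℝ) :=
  ⟨(dWb_pos_iff (by norm_num)).1 dWb_pos, (dWb_neg_iff (by norm_num)).1 dWb_neg⟩

/-- **IDEAL-WALL STABILITY ⇔ WALL INSIDE THE CRITICAL RADIUS**: for every wall `b > a = 1`, ALL admissible displacements
have positive ideal-wall energy in MODEL M_RWM,8, mode `(2,1)`, iff `b < b*`.
[cite: Freidberg2014, §11.5.3 eq. (11.118); §11.5.6 p. 491] -/
theorem idealWall_stable_iff {b : ℝ} (hb : 1 < b) :
    (∀ ξ : ℝ → ℝ, IsAdmissible ξ → 0 < P8.externalEnergy 2 kk 1 (Vacuum.wallFactor 2 kk 1 b) ξ) ↔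
      b < P8.criticalWallRadius 2 kk 1 Kq08.xi := by
  rw [externalModes_iff, ← externalEnergy_xi, ← dWb_pos_iff hb, Kq08.dWb]

/-! ### Sentence 4: the thin-wall resistive wall mode (Freidberg (11.169)) -/

/-- **THE RWM GROWS FOR EVERY THIN WALL INSIDE THE CRITICAL RADIUS** (`1 < b < b*`, MODEL M_RWM,8, mode `(2,1)`): every `γ`
of the printed relation `γτ_w·δW_b = −δW_∞` with `τ_w > 0` is positive. [cite: Freidberg2014, §11.5.6 eq. (11.169), p. 492] -/
theorem rwm_grows_of_lt {b γ τw : ℝ} (hb : 1 < b) (hlt : b < P8.criticalWallRadius 2 kk 1 Kq08.xi) (hτ : 0 < τw)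
    (h : ResistiveWall.IsThinWallRate Kq08.dWinf (Kq08.dWb b) τw γ) : 0 < γ :=
  h.growth_pos hτ dWinf_neg ((dWb_pos_iff hb).2 hlt)

/-- The rate identity: at a wall `b` with bracket `Λ_b ∈ [lo, up]`, `lo > Λ_crit`, every thin-wall rate satisfies
`(Λ_c⁻ − Λ_∞⁺)/(up − Λ_c⁻) < γτ_w < (Λ_c⁺ − Λ_∞⁻)/(lo − Λ_c⁺)` — here packaged as the linear facts used twice below.
[cite: Freidberg2014, §11.5.6 eq. (11.169)] -/
theorem rate_key {γ τw b : ℝ} (h : ResistiveWall.IsThinWallRate Kq08.dWinf (Kq08.dWb b) τw γ) :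
    γ * τw * (Vacuum.lambdaWall 2 (1 / 5) (1 / 5 * b) - Kq08.lambdaCrit (1 * deriv Kq08.xi 1 / Kq08.xi 1)) =
      Kq08.lambdaCrit (1 * deriv Kq08.xi 1 / Kq08.xi 1) - Vacuum.lambdaInf 2 (1 / 5) := by
  unfold ResistiveWall.IsThinWallRate at h
  rw [Kq08.dWinf, Kq08.dWb, externalEnergy_xi, externalEnergy_xi, Kq07.wallFactorInf_two_eq, Kq07.wallFactor_two_eq,
    boundaryForm_eq_sub, boundaryForm_eq_sub] at h
  have hX0 : Kq08.xi 1 ^ 2 ≠ 0 := xi_one_sq_pos.ne'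
  set Lc := Kq08.lambdaCrit (1 * deriv Kq08.xi 1 / Kq08.xi 1)
  set Li := Vacuum.lambdaInf 2 (1 / 5)
  set Lb := Vacuum.lambdaWall 2 (1 / 5) (1 / 5 * b)
  set X := Kq08.xi 1 ^ 2
  have h' : γ * τw * ((Lb - Lc) / 800 * X) = -((Li - Lc) / 800 * X) := h
  field_simp at h'
  linarith

/-- **SENTENCE 4: THE CERTIFIED RWM RATE AT `b = 6/5·a`: `4.15 < γτ_w < 4.5`** (`γτ_w = (Λ_crit − Λ_∞)/(Λ_b − Λ_crit)`
with `Λ_∞ ∈ [0.99, 0.9909]`, the SHARP bracket `Λ_b(6/25) ∈ [2.8178, 2.8448]` of `RwmFRS1Kq07BesselSharp` (by name),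
`Λ_crit ∈ (2.485362, 2.485363)`; VALIDATED float `4.334`). [cite: Freidberg2014, §11.5.6 eq. (11.169)] -/
theorem rwm_rate_12 {γ τw : ℝ} (h : ResistiveWall.IsThinWallRate Kq08.dWinf (Kq08.dWb (6 / 5)) τw γ) :
    (83 / 20 : ℝ) < γ * τw ∧ γ * τw < (9 / 2 : ℝ) := by
  have key := rate_key h
  rw [show (1 / 5 : ℝ) * (6 / 5) = 6 / 25 by norm_num] at key
  obtain ⟨hc1, hc2⟩ := lambdaCrit_bounds
  obtain ⟨hi1, hi2⟩ := Kq07.lambdaInf_two_bounds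
  obtain ⟨hb1, hb2⟩ := Kq07.lambdaWall_24_bounds_sharp
  set Lc := Kq08.lambdaCrit (1 * deriv Kq08.xi 1 / Kq08.xi 1)
  set Li := Vacuum.lambdaInf 2 (1 / 5)
  set Lb := Vacuum.lambdaWall 2 (1 / 5) (6 / 25)
  have hd : 0 < Lb - Lc := by linarith
  constructor
  · by_contra hle
    rw [not_lt] at hle
    have : γ * τw * (Lb - Lc) ≤ 83 / 20 * (Lb - Lc) := mul_le_mul_of_nonneg_right hle hd.le
    nlinarith
  · by_contra hle
    rw [not_lt] at hle
    have : 9 / 2 * (Lb - Lc) ≤ γ * τw * (Lb - Lc) := mul_le_mul_of_nonneg_right hle hd.le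
    nlinarith

/-- **The RWM grows at the DECLARED thin wall `b = 6/5·a`** (inside `b*`), `τ_w > 0`.
[cite: Freidberg2014, §11.5.6 eq. (11.169)] -/
theorem rwm_grows {γ τw : ℝ} (hτ : 0 < τw) (h : ResistiveWall.IsThinWallRate Kq08.dWinf (Kq08.dWb (6 / 5)) τw γ) :
    0 < γ :=
  rwm_grows_of_lt (by norm_num) (by linarith [criticalWallRadius_bounds.1]) hτ h

/-! ### The typed margin schemas of `ResistiveSchemas.lean` instantiated (model-6's «margin m for E against class C») -/

/-- The RWM data of MODEL M_RWM,8 for CLASS C = {`(2,1)`} with the wall at `r = b`: the two printed reference energies of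
the marginal solution. [instance data] -/
def rwmData (b : ℝ) : ResistiveSchemas.RWMData (ℕ × ℕ) := ⟨{(2, 1)}, fun _ => Kq08.dWinf, fun _ => Kq08.dWb b⟩

/-- **NO-WALL SCHEMA: the printed criterion `δW_∞ > 0` FAILS** on CLASS C = {`(2,1)`} of MODEL M_RWM,8 (every wall `b`).
[cite: Freidberg2014, §11.5.6 eq. (11.151)] -/
theorem noWallSchema_not_criterionHolds (b : ℝ) :
    ¬ (ResistiveSchemas.rwmNoWallSchema (ℕ × ℕ)).CriterionHolds (Kq08.rwmData b) := by
  intro h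
  have h21 := h (2, 1) (by simp [ResistiveSchemas.rwmNoWallSchema, Kq08.rwmData])
  simp only [ResistiveSchemas.rwmNoWallSchema, Kq08.rwmData] at h21
  linarith [dWinf_neg]

/-- **IDEAL-WALL SCHEMA: the criterion `δW_b > 0` HOLDS WITH A POSITIVE MARGIN at `b = 6/5·a`** (margin `m = δW_b(6/5) > 0`
itself) on CLASS C = {`(2,1)`} of MODEL M_RWM,8. [cite: Freidberg2014, §11.5.6 eq. (11.151)] -/
theorem idealWallSchema_hasPositiveMargin :
    (ResistiveSchemas.rwmIdealWallSchema (ℕ × ℕ)).HasPositiveMargin (Kq08.rwmData (6 / 5)) := by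
  refine ⟨Kq08.dWb (6 / 5), dWb_pos, fun i hi => ?_⟩
  simp [ResistiveSchemas.rwmIdealWallSchema, Kq08.rwmData]

/-- **IDEAL-WALL SCHEMA ⇔ WALL INSIDE `b*`**: for every wall `b > a`, the printed ideal-wall criterion holds on CLASS C of MODEL
M_RWM,8 iff `b < b*`. [cite: Freidberg2014, §11.5.6 p. 491] -/
theorem idealWallSchema_criterionHolds_iff {b : ℝ} (hb : 1 < b) :
    (ResistiveSchemas.rwmIdealWallSchema (ℕ × ℕ)).CriterionHolds (Kq08.rwmData b) ↔
      b < P8.criticalWallRadius 2 kk 1 Kq08.xi := by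
  rw [← dWb_pos_iff hb]
  constructor
  · intro h
    have h21 := h (2, 1) (by simp [ResistiveSchemas.rwmIdealWallSchema, Kq08.rwmData])
    simpa [ResistiveSchemas.rwmIdealWallSchema, Kq08.rwmData] using h21
  · intro h i hi
    simpa [ResistiveSchemas.rwmIdealWallSchema, Kq08.rwmData] using h

/-! ### Juxtaposition with row #109 (the `q_a = 7/5` member, `RwmFRS1Kq07*`): one step up in `q_a` -/

/-- **THE WALL MUST COME CLOSER**: `b*(M_RWM,8) < 13/10·a < 31/20·a < b*(M_RWM,K)` — the critical wall radius of the `(2,1)`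
mode of the `q_a = 8/5` member lies inside that of the `q_a = 7/5` member (row #109's `Kq07.criticalWallRadius_bounds_sharp`,
by name; two kernel rows about two members of one family, never merged). [instance data] -/
theorem criticalWallRadius_lt_Kq07 :
    P8.criticalWallRadius 2 kk 1 Kq08.xi < Kq07.PK.criticalWallRadius 2 kk 1 Kq07.xi := by
  have h8 := criticalWallRadius_bounds.2
  have h7 := Kq07.criticalWallRadius_bounds_sharp.1
  linarith

/-- **AT THE SAME WALL `b = 6/5·a` THE `q_a = 8/5` MEMBER'S RWM GROWS AT LEAST FIFTEEN TIMES FASTER** (in units of `τ_w`):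
every thin-wall rate of M_RWM,8 exceeds fifteen times every thin-wall rate of M_RWM,K (row #109's `Kq07.rwm_rate_12_sharp`:
`γτ_w < 0.2731` there; `15 × 0.2731 < 4.15`). [cite: Freidberg2014, §11.5.6 eq. (11.169)] -/
theorem rwm_rate_12_gt_Kq07 {γ τw γ' τw' : ℝ} (h : ResistiveWall.IsThinWallRate Kq08.dWinf (Kq08.dWb (6 / 5)) τw γ)
    (h' : ResistiveWall.IsThinWallRate Kq07.dWinf (Kq07.dWb (6 / 5)) τw' γ') : 15 * (γ' * τw') < γ * τw := by
  have h1 := (rwm_rate_12 h).1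
  have h2 := (Kq07.rwm_rate_12_sharp h').2
  linarith

end Kq08

end RwmFRS1

end Summit.Ventures.FusionMHD.Models

end
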